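import Summits.ResolutionOfSingularities.ResolutionOfSingularities.Theorems.EquisingularLiftEquisingularLiftNatTowerInvDefs
import Summits.ResolutionOfSingularities.ResolutionOfSingularities.Theorems.EquisingularLiftEquisingularLiftNatTowerDefs
import Summits.ResolutionOfSingularities.ResolutionOfSingularities.Theorems.EquisingularLiftEquisingularLiftNatTowerExceptionalDense
import HarnessLib

/-!
# [OURS · L1 W4.5(b) · EL♮(3)] HSUB′(ReachTower₃)₃ — a cone-witnessed full multisection is NOWHERE DENSE in its exceptional surface
# (discharge of the assembly stand-in `hDense` / of `hEZ` in `Tower.inv₂_coneRound_old` p560701, from res-L1-w45b-stub-2's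
# `subset_closure_diff_of_flat_of_isEffectiveCartier` …NatTowerExceptionalDense)

res-D-pv-029 g8 (HSUB′(ReachTower)₃ ASSEMBLY). OURS; NOT a statement of any manuscript; AI-written, weaker than expert review. No `sorry`;
standard axioms. DEF-FREE. `--supports stmt-ResolutionOfSingularities-20148 --as helper`.

WHAT. `Tower.subset_closure_diff_of_inv₂_coneWitness`: at a tower stage with `Tower.Inv₂ … G γ T E K`, for a full multisection `Z ⊆ E`
(`TowerFull`) with `ConeWitness G E hE K Z hZ`: `E ⊆ closure (E ∖ Z)`. `Exc₂`'s `NoRound` branch is excluded by `TowerFull`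
(`Tower.not_towerFull_of_noRound`); the forgotten shadow makes `Z = E ∩ closure ∅ = ∅`; otherwise (e-i), (k-ii)+witness, (k-iii) and (k-vi)
are exactly the inputs of res-L1-w45b-stub-2's `subset_closure_diff_of_flat_of_isEffectiveCartier` (it is cone-round data, not ruled-surface
content — stub-2's HONEST correction of my stand-in's attribution).
-/

set_option linter.dupNamespace false -- mandated namespace `Summit.<Summit>.<Problem>` of this single-conjunct summit
set_option linter.overlappingInstances false -- signatures carry `[IsDomain O] [IsDiscreteValuationRing O]`

noncomputable section

open CategoryTheory CategoryTheory.Limits AlgebraicGeometry TopologicalSpace Topology IsLocalRing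
open Literature.AlgebraicGeometry.Resolution
open AlgebraicGeometry.Scheme.IdealSheafData

namespace Summit.ResolutionOfSingularities.ResolutionOfSingularities.Cruxes.EquisingularLiftNat.Sections

/-- **A cone-witnessed full multisection is nowhere dense in its exceptional surface** (see the module docstring).
[cite: GortzWedhorn2020, Prop. 14.57] [OURS · L1 W4.5b] toward `stub_elnat_coneTowerPointResolution`; NOT a statement of the manuscript. -/
theorem Tower.subset_closure_diff_of_inv₂_coneWitness (O : Type) [CommRing O] [IsDomain O] [IsDiscreteValuationRing O] (k : Type) [Field k]
    (θ : O →+* k) (hθ : Function.Surjective θ) (P : Scheme.{0}) (q : P ⟶ Spec (.of O)) (Y : Set P)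
    (Ch : ∀ X' : Scheme.{0}, (X' ⟶ P) → Set X' → Prop) (Ruled : Tower.RuledDatum P)
    {F₉ : Scheme.{0}} (Z₉ : Set F₉) (hZ₉ : IsClosed Z₉) {F₁₀ : Scheme.{0}} (υ' : F₁₀ ⟶ F₉)
    (G : Scheme.{0}) (γ : G ⟶ F₁₀) (T E K : Set G) (hE : IsClosed E) (Z : Set G) (hZ : IsClosed Z)
    (hinv : Tower.Inv₂ O k θ P q Y Ch Ruled F₉ Z₉ hZ₉ F₁₀ υ' G γ T E K) (hfull : TowerFull F₉ F₁₀ υ' Z₉ hZ₉ G γ Z hZ) (hZE : Z ⊆ E)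
    (hcone : ConeWitness G E hE K Z hZ) : E ⊆ closure (E \ Z) := by
  obtain ⟨hυ', hZinf, hGint, hTcl, hTirr, hEcl, hTE, X, σ, S, jG, tG, hCh, hXint, hXnoeth, hXreg, hdom, hsq, hTS, hexc⟩ := hinv
  haveI := hXnoeth
  obtain ⟨hZeq, hwit⟩ := hcone
  rcases hexc hE with hno | ⟨𝓔, he_i, -, -, -, -, hshadow⟩
  · exact absurd hfull (Tower.not_towerFull_of_noRound υ' Z₉ hZ₉ hZinf G γ E hno Z hZ hZE)
  rcases hshadow with hK0 | ⟨𝒦, -, hk_ii, hk_iii, -, -, hk_vi⟩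
  · -- forgotten shadow: the witness forces `Z = ∅`
    rw [hK0, closure_empty, Set.inter_empty] at hZeq
    rw [hZeq, Set.sdiff_empty]
    exact subset_closure
  · have hZi : (𝓔 ⊔ 𝒦).comap jG = vanishingIdeal ⟨Z, hZ⟩ := by
      rw [Scheme.IdealSheafData.comap_sup, he_i, hk_ii, hwit]
    exact subset_closure_diff_of_flat_of_isEffectiveCartier θ hθ q σ jG tG hsq 𝓔 𝒦 hE hZ he_i hZi hk_iii hk_vi

end Summit.ResolutionOfSingularities.ResolutionOfSingularities.Cruxes.EquisingularLiftNat.Sections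

end
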